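import Summits.QuantumAdvantage.AdviceFreeQNC0.AffBells26FlipCubeSieve
import HarnessLib

/-!
# Q0 of the flip-cube sieve: `AffBells26.TargetFormula` PROVED (planner qn-p1 g26, ROUND-25 §5; ask P-26 (a))

Prover seat qn-prover-3 g14.  **`targetFormula : TargetFormula`** — on the odd class of the `N`-cycle (`N ≥ 3`), for every answer
string `z`,  `Rel x z ⟺ #{b active : z_b} + N + Z + p ≡ 0 (mod 2)`, with `J = kline x`, `Z = zeros J` (coins) and
`p = pairs2 J` (coin pairs at cyclic distance two): the win target is a QUADRATIC function of the coin set.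

Proof (the planner's route): on the odd class the kernel is the line `{0, J}` (`RingKernel.kernel_odd`), so `Rel x z ⟺ ⟨J, z⟩ ≡ ℓ_x(J)`
(`rel_iff_dot2_kline`) with `ℓ_x(J) = e(J) + |x ∧ J|/2`; for the hard-core line `J` (`Fib19.kline_hardCore`):
* `edgesIn_add_two_zeros`: `e(J) + 2Z = N` (the non-edges are `{b : J_b = 0} ⊔ {b : J_{b+1} = 0}`, disjoint by hard-core);
* `wtAnd_kline_add`: `|x ∧ J| + 2p = 2Z` (on `supp J`, `x_b = J_{b−1} ⊕ J_{b+1}` by `Fib19.apply_eq_of_kline`, so `|x ∧ J|` counts the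
  active `b` with exactly one coin neighbour; seen from the coins, each coin `i` contributes `[J_{i+2} = 1] + [J_{i−2} = 1]`,
  i.e. `2(Z − p)` in total);
hence `ℓ_x(J) ≡ N − 2Z + Z − p ≡ N + Z + p`.

WHAT THIS IS NOT: instrument for the (NP₀) rung of crux stmt-QuantumAdvantage-22907 (route DWalkThree); Q1/Q1'/Q2/Q3 of Sketch26 are
NOT proved here; separation NOT moved.
-/

namespace Summit.QuantumAdvantage.AdviceFreeQNC0

namespace AffBells26

open Finset Literature.Computability.QuantumComplexity Literature.Computability.QuantumComplexity.RingHLF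
open AffBells23 Fib19

variable {N : ℕ}

/-! ### The relation on the odd class is one parity condition -/

/-- On the odd class the kernel is `{0, J}`, so `Rel x z ⟺ ⟨J, z⟩ ≡ ℓ_x(J)` with `J = kline x`. -/
theorem rel_iff_dot2_kline (hN : 3 ≤ N) (x : Fin N → Bool) (hodd : IsOdd x) (z : Fin N → Bool) :
    RingHLF.Rel x z ↔ dot2 (kline x) z = signBit x (kline x) := by
  constructor
  · intro h
    exact h _ (kline_inKernel hN x hodd)
  · intro h v hv
    rcases (kernel_odd hN x hodd v).1 hv with rfl | rfl
    · unfold dot2 signBit edgesIn wtAnd; simp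
    · exact h

/-- `⟨J, z⟩ mod 2` is the parity of the number of active set answer bits. -/
theorem dot2_kline_eq (x z : Fin N → Bool) : dot2 (kline x) z = activeOnes x z % 2 := rfl

/-! ### Counting on the cycle -/

/-- Re-indexing a count along a bijection of the positions with a two-sided inverse. -/
theorem card_filter_comp (σ τ : Fin N → Fin N) (h1 : ∀ i, σ (τ i) = i) (h2 : ∀ i, τ (σ i) = i)
    (P : Fin N → Prop) [DecidablePred P] :
    (univ.filter fun b => P (σ b)).card = (univ.filter P).card := by
  refine card_bij (fun b _ => σ b) (fun b hb => ?_) (fun b _ b' _ h => ?_) (fun i hi => ?_)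
  · rw [mem_filter] at hb ⊢; exact ⟨mem_univ _, hb.2⟩
  · have := congrArg τ h; rwa [h2, h2] at this
  · refine ⟨τ i, ?_, h1 i⟩
    rw [mem_filter] at hi ⊢
    exact ⟨mem_univ _, by rw [h1]; exact hi.2⟩

/-- **`e(J) + 2Z = N`** for a hard-core `J`: the `N − e(J)` non-edges `{b : ¬(J_b ∧ J_{b+1})}` split as
`{b : J_b = 0} ⊔ {b : J_{b+1} = 0}`, the two parts being disjoint (no two adjacent coins) and each of size `Z`. -/
theorem edgesIn_add_two_zeros (J : Fin N → Bool) (hJ : HardCore J) : edgesIn J + 2 * zeros J = N := by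
  have hsplit := card_filter_add_card_filter_not (s := (univ : Finset (Fin N)))
    (fun b : Fin N => J b = true ∧ J (nxt b) = true)
  rw [card_univ, Fintype.card_fin] at hsplit
  have hnot : (univ.filter fun b : Fin N => ¬ (J b = true ∧ J (nxt b) = true)) =
      (univ.filter fun b : Fin N => J b = false) ∪ univ.filter fun b : Fin N => J (nxt b) = false := by
    ext b
    simp only [mem_filter, mem_univ, true_and, mem_union]
    cases J b <;> cases J (nxt b) <;> simp
  have hdisj : Disjoint (univ.filter fun b : Fin N => J b = false) (univ.filter fun b : Fin N => J (nxt b) = false) := by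
    rw [disjoint_left]
    intro b hb hb'
    rw [mem_filter] at hb hb'
    exact hJ.1 b ⟨hb.2, hb'.2⟩
  have hshift : (univ.filter fun b : Fin N => J (nxt b) = false).card = zeros J := by
    unfold zeros
    exact card_filter_comp nxt prv nxt_prv prv_nxt (fun i => J i = false)
  rw [hnot, card_union_of_disjoint hdisj, hshift] at hsplit
  unfold edgesIn zeros at *
  omega

/-- Coins split by the coin two steps ahead: `#{i coin : J_{i+2} = 1} + p = Z`. -/
theorem coins_split_nxt (J : Fin N → Bool) :
    (univ.filter fun i : Fin N => J i = false ∧ J (nxt (nxt i)) = true).card + pairs2 J = zeros J := by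
  unfold pairs2 zeros
  rw [← card_filter_add_card_filter_not (s := univ.filter fun i : Fin N => J i = false)
    (fun i => J (nxt (nxt i)) = true), filter_filter, filter_filter]
  congr 2
  ext i
  simp only [mem_filter, mem_univ, true_and, Bool.not_eq_true]

/-- Coins split by the coin two steps behind: `#{i coin : J_{i−2} = 1} + p = Z` (re-indexed by `i ↦ i + 2`). -/
theorem coins_split_prv (J : Fin N → Bool) :
    (univ.filter fun i : Fin N => J i = false ∧ J (prv (prv i)) = true).card + pairs2 J = zeros J := by
  have hp : pairs2 J = (univ.filter fun i : Fin N => J i = false ∧ J (prv (prv i)) = false).card := by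
    unfold pairs2
    rw [← card_filter_comp (fun i => nxt (nxt i)) (fun i => prv (prv i))
      (fun i => by simp only [nxt_prv]) (fun i => by simp only [prv_nxt])
      (fun i => J i = false ∧ J (prv (prv i)) = false)]
    congr 1
    ext i
    simp only [mem_filter, mem_univ, true_and, prv_nxt]
    exact And.comm
  rw [hp]
  unfold zeros
  rw [← card_filter_add_card_filter_not (s := univ.filter fun i : Fin N => J i = false)
    (fun i => J (prv (prv i)) = true), filter_filter, filter_filter]
  congr 2
  ext i
  simp only [mem_filter, mem_univ, true_and, Bool.not_eq_true]

/-- **`|x ∧ J| + 2p = 2Z`** on the odd class: `x_b = J_{b−1} ⊕ J_{b+1}` on the support of `J`, so `|x ∧ J|` counts the active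
positions with exactly one coin neighbour, i.e. `#{i coin : J_{i+2} = 1} + #{i coin : J_{i−2} = 1} = 2(Z − p)`. -/
theorem wtAnd_kline_add (hN : 3 ≤ N) (x : Fin N → Bool) (hodd : IsOdd x) :
    wtAnd x (kline x) + 2 * pairs2 (kline x) = 2 * zeros (kline x) := by
  set J := kline x with hJdef
  have hJ : HardCore J := kline_hardCore hN x hodd
  -- active with a coin on the left / on the right
  set S₁ := univ.filter fun b : Fin N => J (prv b) = false ∧ J (nxt b) = true with hS₁
  set S₂ := univ.filter fun b : Fin N => J (prv b) = true ∧ J (nxt b) = false with hS₂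
  have hxJ : (univ.filter fun b : Fin N => x b = true ∧ J b = true) = S₁ ∪ S₂ := by
    ext b
    rw [mem_union, hS₁, hS₂, mem_filter, mem_filter, mem_filter]
    simp only [mem_univ, true_and]
    constructor
    · rintro ⟨hx, hb⟩
      have h := apply_eq_of_kline hN x hodd b hb
      rw [← hJdef, hx] at h
      revert h
      cases J (prv b) <;> cases J (nxt b) <;> simp
    · intro h
      -- in both cases `b` is active by the hard-core property
      have hb : J b = true := by
        rcases h with ⟨h1, _⟩ | ⟨_, h2⟩
        · by_contra hb
          rw [Bool.not_eq_true] at hb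
          exact hJ.1 (prv b) ⟨h1, by rw [nxt_prv]; exact hb⟩
        · by_contra hb
          rw [Bool.not_eq_true] at hb
          exact hJ.1 b ⟨hb, h2⟩
      refine ⟨?_, hb⟩
      rw [apply_eq_of_kline hN x hodd b hb]
      rcases h with ⟨h1, h2⟩ | ⟨h1, h2⟩
      · rw [← hJdef, h1, h2]; rfl
      · rw [← hJdef, h1, h2]; rfl
  have hdisj : Disjoint S₁ S₂ := by
    rw [disjoint_left]
    intro b hb hb'
    rw [hS₁, mem_filter] at hb
    rw [hS₂, mem_filter] at hb'
    rw [hb.2.1] at hb'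
    exact Bool.false_ne_true hb'.2.1
  -- re-index S₁ by the left coin and S₂ by the right coin
  have h1 : S₁.card = (univ.filter fun i : Fin N => J i = false ∧ J (nxt (nxt i)) = true).card := by
    rw [hS₁, ← card_filter_comp prv nxt prv_nxt nxt_prv (fun i => J i = false ∧ J (nxt (nxt i)) = true)]
    congr 1
    ext b
    simp only [mem_filter, mem_univ, true_and, nxt_prv]
  have h2 : S₂.card = (univ.filter fun i : Fin N => J i = false ∧ J (prv (prv i)) = true).card := by
    rw [hS₂, ← card_filter_comp nxt prv nxt_prv prv_nxt (fun i => J i = false ∧ J (prv (prv i)) = true)]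
    congr 1
    ext b
    simp only [mem_filter, mem_univ, true_and, prv_nxt]
    exact And.comm
  have hA := coins_split_nxt J
  have hB := coins_split_prv J
  unfold wtAnd
  rw [hxJ, card_union_of_disjoint hdisj, h1, h2]
  omega

/-! ### Q0 -/

/-- **Q0, `TargetFormula`** (planner qn-p1 g26, ROUND-25 §5): on the odd class
`Rel x z ⟺ #{active b : z_b} + N + zeros (kline x) + pairs2 (kline x) ≡ 0 (mod 2)`. -/
theorem targetFormula : TargetFormula := by
  intro N hN x hodd z
  rw [rel_iff_dot2_kline hN x hodd z, dot2_kline_eq]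
  have he := edgesIn_add_two_zeros (kline x) (kline_hardCore hN x hodd)
  have hw := wtAnd_kline_add hN x hodd
  unfold signBit
  constructor
  · intro h; omega
  · intro h; omega

end AffBells26

end Summit.QuantumAdvantage.AdviceFreeQNC0
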